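import Summits.BirchSwinnertonDyer.BirchSwinnertonDyer.Theorems.ManinLocalTwoThreeCongruenceNumberTwistInvariance
import Summits.BirchSwinnertonDyer.Rank1Residual.O5.CongruenceNumberTwistPrime
import Summits.BirchSwinnertonDyer.Rank1Residual.ManinAdditive.TwistingIsogenyAtThree
import HarnessLib

/-!
# E-desc-62′ `CongruenceNumberTwistInvarianceOdd` holds: `r_{D.f} = r_{D′.f}` on same-conductor `p*`-twist pairs, `p` odd

Summit `BirchSwinnertonDyer`, sub-problem `BirchSwinnertonDyer`, route `ManinLocalTwoThree`; width seat `bsd-line-manin23-p2`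
(gen 9), `--supports` the crux C3 `ManinPrimeToThreeAtNine` (stmt-BirchSwinnertonDyer-22968).  Cell `bsd-f2-manin`, desc
g9 leaf `…ManinAdditive.TwistingIsogenyAtThree` (typer T-desc-13): the row E-desc-62′ is the odd-prime twin of E-desc-62
(discharged by `congruenceNumberTwistInvarianceAtThree`, p645903 / `TwistingIsogenyAtThreeHolds`).  It is a THEOREM by the
O5 cell's TWIN machinery (`Summit.BirchSwinnertonDyer.Rank1Residual.O5.PrimeTwist.congruenceNumber_charTwist_of_isNewform0`,
2026-08-21: the twist `R_χ`, `χ = (·/p)`, is a Petersson isometry swapping `f` and `f ⊗ χ` on `S₂(Γ₀(N))`, `p² ∣ N`) plus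
the glue «`W ⊗ p* ∼ W′` at a common level `p² ∣ N` ⟹ `f_{W′} = f_W ⊗ (·/p)`» (`cuspCoeff_eq_chi_mul_of_twist_pStar`,
Knapp Prop. 11.67 via `LFunction_eq_of_isIsogenous`).

PROVED here (sorry-free):
* `f_eq_charTwist_of_isIsogenous_quadraticTwist_pStar` — `D′.f = D.f ⊗ (·/p)` for data at a common level `p² ∣ N`,
  `W′` additive at `p`, `W ⊗ p* ∼ W′` (`p` odd);
* `congruenceNumber_eq_of_isIsogenous_quadraticTwist_pStar` — hence `r_{D.f} = r_{D′.f}`;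
* **`congruenceNumberTwistInvarianceOdd_holds : CongruenceNumberTwistInvarianceOdd`** — E-desc-62′ BY NAME.

No new mathematics (assembly of O5's TWIN and the tree's twist–isogeny glue); recorded so that the leaf's obligation closes
by name.  BSD is not proved by this; Manin's conjecture is not proved by this; C3 is not closed by this.
-/

set_option autoImplicit false
set_option linter.dupNamespace false

noncomputable section

open scoped MatrixGroups ModularForm
open CongruenceSubgroup WeierstrassCurve
open Literature.NumberTheory.EllipticCurves Literature.NumberTheory.EllipticCurves.ModularForms
open Summit.BirchSwinnertonDyer.Rank1Residual.ManinAdditive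
open Summit.BirchSwinnertonDyer.Rank1Residual.ManinAdditive.TwistingIsogenyAtThree

namespace Summit.BirchSwinnertonDyer.BirchSwinnertonDyer.Theorems.ManinLocalTwoThree

/-- **`f_{W′} = f_W ⊗ (·/p)`** for data of `W, W′` at a common level `p² ∣ N` (`p` an odd prime), `W′` additive at `p`
(`p² ∣ N_{W′}`), `W ⊗ p* ∼ W′` with `p* = (−1)^{(p−1)/2} p`. -/
theorem f_eq_charTwist_of_isIsogenous_quadraticTwist_pStar {p : ℕ} [Fact p.Prime] (hp2 : p ≠ 2)
    {W W' : WeierstrassCurve ℚ} [W.IsElliptic] [W'.IsElliptic] {N : ℕ} [NeZero N]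
    (D : ModularParametrizationData W N) (D' : ModularParametrizationData W' N) (hpN : p ^ 2 ∣ N)
    (hpW' : p ^ 2 ∣ W'.conductorNorm ℤ)
    (hiso : IsIsogenous (W.quadraticTwist (((-1 : ℤ) ^ ((p - 1) / 2) * p : ℤ) : ℚ)) W') :
    D'.f = charTwist N dvd_rfl hpN (isQuadratic_quadraticChar_ringHomComp p) D.f := by
  have hp : p.Prime := Fact.out
  have hW' : ¬ W'.HasGoodReductionAtPrime p ∧ ¬ W'.HasMultiplicativeReductionAtPrime p :=
    not_good_and_not_mult_of_sq_dvd_conductorNorm W' hpW'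
  have hW'0 : ∀ n : ℕ, p ∣ n → W'.LFunction n = 0 := fun n hn =>
    W'.LFunction_apply_eq_zero_of_not_good_of_not_mult p hW'.1 hW'.2 hn
  have hhalf : (p - 1) / 2 = p / 2 := by
    obtain ⟨k, hk⟩ := hp.odd_of_ne_two hp2
    omega
  rw [hhalf] at hiso
  have hdZ : ((-1 : ℤ) ^ (p / 2) * p : ℤ) ≠ 0 :=
    mul_ne_zero (pow_ne_zero _ (by norm_num)) (by exact_mod_cast hp.ne_zero)
  have hd0 : ((((-1 : ℤ) ^ (p / 2) * p : ℤ)) : ℚ) ≠ 0 := by exact_mod_cast hdZ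
  haveI : (W.quadraticTwist (((-1 : ℤ) ^ (p / 2) * p : ℤ) : ℚ)).IsElliptic := W.isElliptic_quadraticTwist hd0
  have hu : (1 : VariableChange ℚ) • W.quadraticTwist (((-1 : ℤ) ^ (p / 2) * p : ℤ) : ℚ) =
      W.quadraticTwist (((-1 : ℤ) ^ (p / 2) * p : ℤ) : ℚ) := one_smul _ _
  have hLC : (W.quadraticTwist (((-1 : ℤ) ^ (p / 2) * p : ℤ) : ℚ)).LFunction = W'.LFunction :=
    LFunction_eq_of_isIsogenous_holds _ _ hiso
  refine eq_of_forall_cuspCoeff_eq_gamma0 fun n => ?_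
  rw [cuspCoeff_charTwist (L := N) (hN := dvd_rfl) (hm := hpN) (hχ := isQuadratic_quadraticChar_ringHomComp p)
    (hprim := isPrimitive_quadraticChar_ringHomComp p hp2) (f := D.f) (n := n)]
  exact cuspCoeff_eq_chi_mul_of_twist_pStar hp2 1 hu hLC hW'0 D D' n

/-- `r_{D.f} = r_{D′.f}` under the same hypotheses (O5's TWIN `congruenceNumber_charTwist_of_isNewform0`). -/
theorem congruenceNumber_eq_of_isIsogenous_quadraticTwist_pStar {p : ℕ} [Fact p.Prime] (hp2 : p ≠ 2)
    {W W' : WeierstrassCurve ℚ} [W.IsElliptic] [W'.IsElliptic] {N N' : ℕ} [NeZero N] [NeZero N']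
    (D : ModularParametrizationData W N) (D' : ModularParametrizationData W' N') (hNN' : N' = N) (hpN : p ^ 2 ∣ N)
    (hpW' : p ^ 2 ∣ W'.conductorNorm ℤ)
    (hiso : IsIsogenous (W.quadraticTwist (((-1 : ℤ) ^ ((p - 1) / 2) * p : ℤ) : ℚ)) W') :
    congruenceNumber D.f = congruenceNumber D'.f := by
  subst hNN'
  rw [f_eq_charTwist_of_isIsogenous_quadraticTwist_pStar hp2 D D' hpN hpW' hiso,
    Summit.BirchSwinnertonDyer.Rank1Residual.O5.PrimeTwist.congruenceNumber_charTwist_of_isNewform0 hpN (isQuadratic_quadraticChar_ringHomComp p)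
      (isPrimitive_quadraticChar_ringHomComp p hp2) D.isNewformOf.1]

/-- **E-desc-62′ `CongruenceNumberTwistInvarianceOdd` IS A THEOREM** (desc g9 leaf `TwistingIsogenyAtThree`): for an odd
prime `p`, data `D, D′` of `W, W′` at their common conductor `N` with `p² ∣ N` and `W ⊗ p* ∼ W′`, `r_{D.f} = r_{D′.f}`.
Assembly of O5's TWIN (2026-08-21) and the twist–isogeny glue; BSD is not proved by this. -/
theorem congruenceNumberTwistInvarianceOdd_holds : CongruenceNumberTwistInvarianceOdd := by
  intro p hp hp2 W W' _ _ _ _ D D' hpN hN hiso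
  haveI : Fact p.Prime := ⟨hp⟩
  exact congruenceNumber_eq_of_isIsogenous_quadraticTwist_pStar hp2 D D' hN hpN (by rw [hN]; exact hpN) hiso

end Summit.BirchSwinnertonDyer.BirchSwinnertonDyer.Theorems.ManinLocalTwoThree

end
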